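import Literature.AlgebraicGeometry.Dimension.SmoothRelativeDimensionBound
import Literature.AlgebraicGeometry.KTheory.HuInfinitesimalKZeroProofs
import Mathlib.RingTheory.WittVector.DiscreteValuationRing
import Mathlib.RingTheory.DiscreteValuationRing.TFAE
import HarnessLib

/-!
# Dimension vanishing for the hypercohomology of X. Hu's complexes on a smooth proper `W(k)`-model

Companion to the named facts `KTheory.HuKZeroKernelPresentation` / `KTheory.HuKZeroLiftingCriterion`
(`KTheory/HuInfinitesimalKZero`, X. Hu, arXiv:2507.12458) and to
`KTheory.huH_eq_zero_of_lt` (`KTheory/HuInfinitesimalKZeroProofs`), which proves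
`ℍⁱ(p^{r,M}_{r,N}Ω•) = 0` for `i > (r − 1) + c` on a space of cohomological dimension `≤ c` but
leaves the cohomological dimension as a hypothesis. Here that hypothesis is DISCHARGED for the
schemes the facts quantify over:

* `WittScheme.topologicalKrullDim_le_of_smoothOfRelativeDimension` — a `W(k)`-scheme (`k` a
  perfect field of characteristic `p`, so that `W(k)` is a discrete valuation ring, Mathlib
  `WittVector.isDiscreteValuationRing`, of Krull dimension `≤ 1`) smooth of relative dimension `d`
  has `dim |𝒳| ≤ d + 1` (`Dimension.topologicalKrullDim_le_of_smoothOfRelativeDimension`: the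
  dimension formula for the étale charts, Stacks 00ON);
* `WittScheme.isNoetherian_of_smoothOfRelativeDimension`,
  `WittScheme.hasCohomologicalDimensionLE_of_smoothOfRelativeDimension` — a quasi-compact
  `W(k)`-scheme smooth of relative dimension `d` is noetherian and the Zariski site of `|𝒳|` has
  cohomological dimension `≤ d + 1` (Grothendieck vanishing,
  `Crystalline.hasCohomologicalDimensionLE_of_noetherianSpace`); the specialisations
  `WittScheme.IsSmoothProperModel.isNoetherian`, `…noetherianSpace`, `…topologicalKrullDim_le`,
  `…hasCohomologicalDimensionLE` to the tree's smooth proper models;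
* `huH_eq_zero_of_isSmoothProperModel` — `ℍⁱ(|𝒳|, p^{r,M}_{r,N}Ω•) = 0` for `i > r + d`;
* `HuKernelSource.apply_eq_zero_of_lt` — the components `r > d + 1` of the source
  `⊕_{r=1}^{p−1} ℍ^{2r−1}(p^{r,m}_{r,n}Ω•)` of Hu's kernel presentation vanish: in Cor. 10.5 (i) of
  arXiv:2507.12458 (there on `|X_1|`, of dimension `d`, the summands `r > d` vanish; on `|𝒳|`,
  where the tree takes hypercohomology — caveat (β) of `KTheory/HuInfinitesimalKZero` — one more
  value of `r` survives formally) the sum is effectively over `1 ≤ r ≤ d + 1`;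
* `huHReduce_surjective_of_lt` — in degrees `i > r + d` the level reductions
  `ℍⁱ(p^{r,M}_{r,N'}Ω•) → ℍⁱ(p^{r,M}_{r,N}Ω•)` are (trivially) surjective; in particular
  (`huHReduce_odd_surjective_of_lt`) the odd transitions
  `ℍ^{2r−1}(p^{r,M}_{r,N'}Ω•) → ℍ^{2r−1}(p^{r,M}_{r,N}Ω•)` are onto for `d + 1 < r`, which is the range
  `d + 2 ≤ r < p` of the lattice statement (S) consumed together with `HuKZeroKernelPresentation`
  by crux `FormalLiftingFromClassLifting` of route `HodgeConjecture/PadicSemiregularLift`.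

## References

* X. Hu, *On the algebraic K-theory of smooth schemes over truncated Witt vectors*,
  arXiv:2507.12458 (2025), Cor. 10.5 (i) (p. 52), proof of Prop. 11.1 (p. 65: "For `r ≥ d + i`,
  `H^{2r−i−j}(X_1, p^{r,m}_{r,n}Ωʲ)` vanishes because `2r − i − j ≥ r + 1 − i ≥ d + 1`").
  [Hu2025TruncatedWitt]
* The Stacks project, Tag 00ON. [StacksProject]
* R. Hartshorne, *Algebraic Geometry* (1977), III Thm. 2.7 (Grothendieck vanishing). [Hartshorne1977]
-/

noncomputable section

universe u

open CategoryTheory _root_.AlgebraicGeometry _root_.TopologicalSpace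

/-! ### Dimension and noetherianity of smooth (proper) `W(k)`-schemes -/

namespace Literature.AlgebraicGeometry.Motives.WittScheme

variable {p : ℕ} [Fact p.Prime] {k : Type u} [Field k] [CharP k p] [PerfectRing k p]

/-- For a perfect field `k` of characteristic `p`, `W(k)` is a discrete valuation ring, hence of
Krull dimension `≤ 1` (Mathlib `WittVector.isDiscreteValuationRing`). [folklore] -/
theorem ringKrullDim_wittVector_le_one : ringKrullDim (WittVector p k) ≤ 1 :=
  Ring.krullDimLE_iff.mp inferInstance

/-- **A `W(k)`-scheme smooth of relative dimension `d` has dimension at most `d + 1`** (`k` perfect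
of characteristic `p`): `dim |𝒳| ≤ dim W(k) + d ≤ 1 + d`
(`Dimension.topologicalKrullDim_le_of_smoothOfRelativeDimension_of_le`, the dimension formula for
the étale charts of a smooth morphism). [cite: StacksProject, Tag 00ON] -/
theorem topologicalKrullDim_le_of_smoothOfRelativeDimension (d : ℕ)
    (𝒳 : SchemeOver (WittVector p k)) [SmoothOfRelativeDimension d 𝒳.hom] :
    topologicalKrullDim 𝒳.left ≤ (d + 1 : ℕ) := by
  haveI : IsNoetherianRing (CommRingCat.of (WittVector p k)) :=
    inferInstanceAs (IsNoetherianRing (WittVector p k))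
  rw [Nat.add_comm]
  exact Dimension.topologicalKrullDim_le_of_smoothOfRelativeDimension_of_le 𝒳.hom d
    (e := 1) ringKrullDim_wittVector_le_one

/-- A quasi-compact `W(k)`-scheme smooth of relative dimension `d` (`k` perfect of characteristic
`p`) is a noetherian scheme: locally of finite type over the noetherian ring `W(k)` (smooth ⇒ locally
of finite presentation) and quasi-compact. [folklore] -/
theorem isNoetherian_of_smoothOfRelativeDimension (d : ℕ) (𝒳 : SchemeOver (WittVector p k))
    [SmoothOfRelativeDimension d 𝒳.hom] [QuasiCompact 𝒳.hom] : IsNoetherian 𝒳.left := by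
  haveI : IsNoetherianRing (CommRingCat.of (WittVector p k)) :=
    inferInstanceAs (IsNoetherianRing (WittVector p k))
  haveI : Smooth 𝒳.hom := SmoothOfRelativeDimension.smooth d 𝒳.hom
  haveI : IsLocallyNoetherian 𝒳.left := LocallyOfFiniteType.isLocallyNoetherian 𝒳.hom
  haveI : CompactSpace 𝒳.left := QuasiCompact.compactSpace_of_compactSpace 𝒳.hom
  exact {}

/-- **The Zariski site of a quasi-compact `W(k)`-scheme smooth of relative dimension `d` has
cohomological dimension `≤ d + 1`** (`k` perfect of characteristic `p`): Grothendieck vanishing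
(`Crystalline.hasCohomologicalDimensionLE_of_noetherianSpace`, Hartshorne III.2.7) on the noetherian
space `|𝒳|` of dimension `≤ d + 1` (`topologicalKrullDim_le_of_smoothOfRelativeDimension`). This
covers the objects of `Sm_{W•(k)}` of arXiv:2507.12458 (§1.7: systems `X_n → Spec W_n(k)` "smooth
separated and of finite type", e.g. "the object of `Sm_{W•(k)}` associated with" a smooth separated
finite-type `W(k)`-scheme) that come from a quasi-compact smooth `W(k)`-scheme — the case of the
tree's facts (caveat (ε) of `KTheory/HuInfinitesimalKZero`). [cite: Hartshorne1977, III Thm. 2.7] -/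
theorem hasCohomologicalDimensionLE_of_smoothOfRelativeDimension (d : ℕ)
    (𝒳 : SchemeOver (WittVector p k)) [SmoothOfRelativeDimension d 𝒳.hom] [QuasiCompact 𝒳.hom] :
    Crystalline.HasCohomologicalDimensionLE.{u} (Opens.grothendieckTopology 𝒳.left) (d + 1) :=
  haveI := isNoetherian_of_smoothOfRelativeDimension d 𝒳
  Crystalline.hasCohomologicalDimensionLE_of_noetherianSpace 𝒳.left.carrier (d + 1)
    (topologicalKrullDim_le_of_smoothOfRelativeDimension d 𝒳)

/-- A smooth proper model `𝒳/W(k)` is a noetherian scheme (locally of finite type over the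
noetherian ring `W(k)` and quasi-compact). [folklore] -/
theorem IsSmoothProperModel.isNoetherian {d : ℕ} {𝒳 : SchemeOver (WittVector p k)}
    (h : IsSmoothProperModel d 𝒳) : IsNoetherian 𝒳.left :=
  haveI := h.smoothOfRelativeDimension
  haveI := h.isProper
  isNoetherian_of_smoothOfRelativeDimension d 𝒳

/-- The underlying space of a smooth proper model `𝒳/W(k)` is noetherian. [folklore] -/
theorem IsSmoothProperModel.noetherianSpace {d : ℕ} {𝒳 : SchemeOver (WittVector p k)}
    (h : IsSmoothProperModel d 𝒳) : NoetherianSpace 𝒳.left :=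
  haveI := h.isNoetherian
  inferInstance

/-- A smooth proper model `𝒳/W(k)` of relative dimension `d` has `dim |𝒳| ≤ d + 1`.
[cite: StacksProject, Tag 00ON] -/
theorem IsSmoothProperModel.topologicalKrullDim_le {d : ℕ} {𝒳 : SchemeOver (WittVector p k)}
    (h : IsSmoothProperModel d 𝒳) : topologicalKrullDim 𝒳.left ≤ (d + 1 : ℕ) :=
  haveI := h.smoothOfRelativeDimension
  topologicalKrullDim_le_of_smoothOfRelativeDimension d 𝒳

/-- **The Zariski site of a smooth proper model `𝒳/W(k)` of relative dimension `d` has cohomological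
dimension `≤ d + 1`** (`hasCohomologicalDimensionLE_of_smoothOfRelativeDimension`; Grothendieck's
vanishing theorem on the noetherian space `|𝒳|` of dimension `≤ d + 1`).
[cite: Hartshorne1977, III Thm. 2.7] -/
theorem IsSmoothProperModel.hasCohomologicalDimensionLE {d : ℕ} {𝒳 : SchemeOver (WittVector p k)}
    (h : IsSmoothProperModel d 𝒳) :
    Crystalline.HasCohomologicalDimensionLE.{u} (Opens.grothendieckTopology 𝒳.left) (d + 1) :=
  haveI := h.smoothOfRelativeDimension
  haveI := h.isProper
  hasCohomologicalDimensionLE_of_smoothOfRelativeDimension d 𝒳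

end Literature.AlgebraicGeometry.Motives.WittScheme

/-! ### Vanishing of `ℍⁱ(p^{r,M}_{r,N}Ω•)` beyond the dimension -/

namespace Literature.AlgebraicGeometry.KTheory

open Literature.AlgebraicGeometry.Motives Literature.AlgebraicGeometry.Motives.WittScheme
  Literature.AlgebraicGeometry.Crystalline

variable {p : ℕ} [Fact p.Prime] {k : Type} [Field k] [CharP k p] [PerfectRing k p]
  {d : ℕ} {𝒳 : SchemeOver (WittVector p k)}

/-- **Vanishing beyond the dimension**: on a smooth proper model `𝒳/W(k)` of relative dimension
`d`, `ℍⁱ(|𝒳|, p^{r,M}_{r,N}Ω•) = 0` for `i > r + d` (the complex is concentrated in degrees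
`[0, r − 1]` and `|𝒳|` has cohomological dimension `≤ d + 1`; `KTheory.huH_eq_zero_of_lt` with
`IsSmoothProperModel.hasCohomologicalDimensionLE`). In the proof of Prop. 11.1 of arXiv:2507.12458
(p. 65) this is the step "For `r ≥ d + i`, `H^{2r−i−j}(X_1, p^{r,m}_{r,n}Ωʲ_{X•})` vanishes because
`2r − i − j ≥ r + 1 − i ≥ d + 1`" (there on `|X_1|`, of dimension `d`; here on `|𝒳|`, of dimension
`≤ d + 1`, caveat (β) of `KTheory/HuInfinitesimalKZero`).
[cite: Hu2025TruncatedWitt, Cor. 10.5 (i) (p. 52) and proof of Prop. 11.1 (p. 65)] -/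
theorem huH_eq_zero_of_isSmoothProperModel (h : IsSmoothProperModel d 𝒳) (r M N : ℕ) {i : ℤ}
    (hi : (r : ℤ) + d < i) (x : huH p k 𝒳 r M N i) : x = 0 :=
  haveI := h.hasCohomologicalDimensionLE
  huH_eq_zero_of_lt p k 𝒳 (d + 1) r M N (by push_cast; omega) x

/-- The hypercohomology group `ℍⁱ(p^{r,M}_{r,N}Ω•)` of a smooth proper model of relative dimension `d`
is trivial for `i > r + d`. [cite: Hu2025TruncatedWitt, Cor. 10.5 (i) (p. 52)] -/
theorem subsingleton_huH_of_isSmoothProperModel (h : IsSmoothProperModel d 𝒳) (r M N : ℕ) {i : ℤ}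
    (hi : (r : ℤ) + d < i) : Subsingleton (huH p k 𝒳 r M N i) :=
  ⟨fun x y => by rw [huH_eq_zero_of_isSmoothProperModel h r M N hi x,
    huH_eq_zero_of_isSmoothProperModel h r M N hi y]⟩

/-- **The components `r > d + 1` of Hu's kernel source vanish**: for a smooth proper model of
relative dimension `d` and `x ∈ ⊕_{r=1}^{p−1} ℍ^{2r−1}(p^{r,m}_{r,n}Ω•)` (`KTheory.HuKernelSource`),
`x_r = 0` whenever `d + 1 < r` (`2r − 1 > r + d`); so the source of `HuKZeroKernelPresentation` is
effectively `⊕_{r=1}^{min(p−1, d+1)}`. [cite: Hu2025TruncatedWitt, Cor. 10.5 (i) (p. 52)] -/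
theorem HuKernelSource.apply_eq_zero_of_lt (h : IsSmoothProperModel d 𝒳) {m n : ℕ}
    (x : HuKernelSource p k 𝒳 m n) (r : {r : ℕ // 1 ≤ r ∧ r < p}) (hr : d + 1 < r.1) :
    x r = 0 :=
  huH_eq_zero_of_isSmoothProperModel h r.1 m n (by omega) (x r)

/-- Two elements of Hu's kernel source on a smooth proper model of relative dimension `d` agree as
soon as their components `r ≤ d + 1` agree. [cite: Hu2025TruncatedWitt, Cor. 10.5 (i) (p. 52)] -/
theorem HuKernelSource.ext_of_le (h : IsSmoothProperModel d 𝒳) {m n : ℕ}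
    {x y : HuKernelSource p k 𝒳 m n}
    (hxy : ∀ r : {r : ℕ // 1 ≤ r ∧ r < p}, r.1 ≤ d + 1 → x r = y r) : x = y := by
  funext r
  by_cases hr : r.1 ≤ d + 1
  · exact hxy r hr
  · rw [HuKernelSource.apply_eq_zero_of_lt h x r (lt_of_not_ge hr),
      HuKernelSource.apply_eq_zero_of_lt h y r (lt_of_not_ge hr)]

/-- **Trivial surjectivity of the level reductions beyond the dimension**: for `i > r + d` the
reduction `ℍⁱ(p^{r,M}_{r,N'}Ω•) → ℍⁱ(p^{r,M}_{r,N}Ω•)` (`KTheory.huHReduce`) is surjective, its target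
being zero. [cite: Hu2025TruncatedWitt, Cor. 10.5 (i) (p. 52)] -/
theorem huHReduce_surjective_of_lt (h : IsSmoothProperModel d 𝒳) (r M : ℕ) {N N' : ℕ}
    (hN : N ≤ N') {i : ℤ} (hi : (r : ℤ) + d < i) :
    Function.Surjective (huHReduce p k 𝒳 r M hN i) := fun y =>
  ⟨0, by rw [map_zero]; exact (huH_eq_zero_of_isSmoothProperModel h r M N hi y).symm⟩

/-- **The odd transitions are onto beyond the dimension**: for `d + 1 < r` the reduction
`ℍ^{2r−1}(p^{r,M}_{r,N'}Ω•) → ℍ^{2r−1}(p^{r,M}_{r,N}Ω•)` is surjective — the range `d + 2 ≤ r < p` of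
the lattice statement "(S) odd transitions are onto" that accompanies `HuKZeroKernelPresentation`
in crux `FormalLiftingFromClassLifting` of route `HodgeConjecture/PadicSemiregularLift`; the
range `1 ≤ r ≤ d + 1` is the genuine coherent-cohomology statement.
[cite: Hu2025TruncatedWitt, Cor. 10.5 (i) (p. 52)] -/
theorem huHReduce_odd_surjective_of_lt (h : IsSmoothProperModel d 𝒳) {r : ℕ} (hr : d + 1 < r)
    (M : ℕ) {N N' : ℕ} (hN : N ≤ N') :
    Function.Surjective (huHReduce p k 𝒳 r M hN (2 * (r : ℤ) - 1)) :=
  huHReduce_surjective_of_lt h r M hN (by omega)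

/-- Product form: the level reduction of Hu's kernel sources (`KTheory.HuKernelSource.reduce`) is
surjective as soon as it is surjective on the components `r ≤ d + 1`.
[cite: Hu2025TruncatedWitt, Cor. 10.5 (i) (p. 52)] -/
theorem HuKernelSource.reduce_surjective_of_le (h : IsSmoothProperModel d 𝒳) (m : ℕ) {n n' : ℕ}
    (hn : n ≤ n')
    (hS : ∀ r : {r : ℕ // 1 ≤ r ∧ r < p}, r.1 ≤ d + 1 →
      Function.Surjective (huHReduce p k 𝒳 r.1 m hn (2 * (r.1 : ℤ) - 1))) :
    Function.Surjective (HuKernelSource.reduce (p := p) (k := k) (𝒳 := 𝒳) m hn) := by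
  intro y
  have hcomp : ∀ r : {r : ℕ // 1 ≤ r ∧ r < p}, ∃ x : huH p k 𝒳 r.1 m n' (2 * (r.1 : ℤ) - 1),
      huHReduce p k 𝒳 r.1 m hn _ x = y r := fun r => by
    by_cases hr : r.1 ≤ d + 1
    · exact hS r hr (y r)
    · exact huHReduce_odd_surjective_of_lt h (lt_of_not_ge hr) m hn (y r)
  choose x hx using hcomp
  exact ⟨x, funext fun r => hx r⟩

end Literature.AlgebraicGeometry.KTheory

end
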